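import Literature.Analysis.FluidPDE.TaoAveragedEulerFormBound

/-!
# Stub B (`bilinearOperator`) for `PerpetualPump.Thesis`, part I: the weighted trilinear estimate

Support file (part 1 of the stub `bilinearOperator` of line `SketchIdeator2`, crux
stmt-NavierStokesRegularity-1832). The analytic heart of the statement "Tao's averaged operator
`B̃` is an honest bilinear operator `H¹⁰_df × H¹⁰_df → H⁹_df`" (T. Tao, J. Amer. Math. Soc. 29
(2016), arXiv:1402.0290v3, §1.1 (1.14): the averaged operators obey the same Sobolev bounds as
`B`, which loses one derivative) is the **`H¹⁰ × H¹⁰ × H⁻⁹` bound for the Euler form (1.3)**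

  `|⟨B(u,v), w⟩| ≤ π · 2¹⁰ · C_emb · ‖u‖_{H¹⁰} ‖v‖_{H¹⁰} ‖w‖_{H⁻⁹}`,
  `C_emb = (∫_{ℝ³} (1+|ξ|²)^{-10})^{1/2}` (`enorm_eulerForm_le_weighted`),

the negative-order companion of the tree's `L²` bound `enorm_eulerForm_le`
(`TaoAveragedEulerFormBound.lean`), on which its proof is modelled: pointwise
`|Λ_{ξ₁,ξ₂}(X₁,X₂,X₃)| ≤ (|ξ₁|+|ξ₂|)|X₁||X₂||X₃|` and the elementary weight inequality
`(|ξ₁|+|ξ₂|) ⟨ξ₁+ξ₂⟩⁹ ≤ 2⁹ (⟨ξ₁⟩¹⁰ + ⟨ξ₂⟩¹⁰)` (`⟨ξ⟩ = √(1+|ξ|²)`, `weight_ineq`), then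
Tonelli and Cauchy–Schwarz in the inner variable
`∫∫ a(ξ₁) b(ξ₂) c(ξ₁+ξ₂) ≤ ‖a‖_{L¹} ‖b‖_{L²} ‖c‖_{L²}` with `b = ⟨ξ⟩¹⁰|f̂|`, `c = ⟨ξ⟩⁻⁹|ĥ|` and
`‖f̂‖_{L¹} ≤ C_emb ‖f‖_{H¹⁰}` (tree: `lintegral_enorm_le_sobolevWeight`).

The Japanese bracket is written `√(1 + ‖ξ‖ ^ 2)` throughout; the `ℝ≥0∞` weights are
`ENNReal.ofReal (√(1 + ‖ξ‖ ^ 2) ^ 10)` (high) and `ENNReal.ofReal ((√(1 + ‖ξ‖ ^ 2))⁻¹ ^ 9)` (low).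

## References

* T. Tao, J. Amer. Math. Soc. 29 (2016), 601–674, arXiv:1402.0290v3, §1.1 (1.3)–(1.4), (1.14).
-/

noncomputable section

open MeasureTheory Set Filter Topology FourierTransform Complex
open scoped ENNReal NNReal

set_option linter.dupNamespace false

namespace Summit.NavierStokesRegularity.NavierStokesRegularity.Theorems.PerpetualPumpThesis.B

open Literature.Analysis.FluidPDE Literature.Analysis.FluidPDE.Tao2016
open Literature.Analysis.FunctionSpaces (eFourierSobolevNorm)

/-! ### The Japanese bracket `⟨ξ⟩ = √(1+|ξ|²)` -/

/-- `⟨ξ⟩² = 1 + |ξ|²`. -/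
theorem jb_sq (ξ : EuclideanSpace ℝ (Fin 3)) : √(1 + ‖ξ‖ ^ 2) ^ 2 = 1 + ‖ξ‖ ^ 2 :=
  Real.sq_sqrt (by positivity)

/-- `⟨ξ⟩ > 0`. -/
theorem jb_pos (ξ : EuclideanSpace ℝ (Fin 3)) : 0 < √(1 + ‖ξ‖ ^ 2) :=
  Real.sqrt_pos.2 (by positivity)

/-- `|ξ| ≤ ⟨ξ⟩`. -/
theorem norm_le_jb (ξ : EuclideanSpace ℝ (Fin 3)) : ‖ξ‖ ≤ √(1 + ‖ξ‖ ^ 2) := by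
  rw [Real.le_sqrt (norm_nonneg _) (by positivity)]
  linarith

/-- The Japanese bracket is subadditive: `⟨ξ + η⟩ ≤ ⟨ξ⟩ + ⟨η⟩`. -/
theorem jb_add_le (ξ η : EuclideanSpace ℝ (Fin 3)) :
    √(1 + ‖ξ + η‖ ^ 2) ≤ √(1 + ‖ξ‖ ^ 2) + √(1 + ‖η‖ ^ 2) := by
  have ha := jb_pos ξ
  have hb := jb_pos η
  have ha2 := jb_sq ξ
  have hb2 := jb_sq η
  have h1 : ‖ξ + η‖ ≤ ‖ξ‖ + ‖η‖ := norm_add_le ξ η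
  have h2 : ‖ξ‖ * ‖η‖ ≤ √(1 + ‖ξ‖ ^ 2) * √(1 + ‖η‖ ^ 2) :=
    mul_le_mul (norm_le_jb ξ) (norm_le_jb η) (norm_nonneg _) ha.le
  rw [Real.sqrt_le_iff]
  refine ⟨by positivity, ?_⟩
  nlinarith [mul_self_le_mul_self (norm_nonneg _) h1, norm_nonneg ξ, norm_nonneg η]

/-- The Japanese bracket is continuous. -/
theorem continuous_jb : Continuous fun ξ : EuclideanSpace ℝ (Fin 3) => √(1 + ‖ξ‖ ^ 2) := by
  fun_prop

/-- **The weight inequality** behind the one-derivative loss of `B`: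
`(|ξ₁| + |ξ₂|) ⟨ξ₁+ξ₂⟩⁹ ≤ 2⁹ (⟨ξ₁⟩¹⁰ + ⟨ξ₂⟩¹⁰)`. -/
theorem weight_ineq (ξ₁ ξ₂ : EuclideanSpace ℝ (Fin 3)) :
    (‖ξ₁‖ + ‖ξ₂‖) * √(1 + ‖ξ₁ + ξ₂‖ ^ 2) ^ 9 ≤
      2 ^ 9 * (√(1 + ‖ξ₁‖ ^ 2) ^ 10 + √(1 + ‖ξ₂‖ ^ 2) ^ 10) := by
  have ha := jb_pos ξ₁
  have hb := jb_pos ξ₂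
  have h1 : ‖ξ₁‖ + ‖ξ₂‖ ≤ √(1 + ‖ξ₁‖ ^ 2) + √(1 + ‖ξ₂‖ ^ 2) :=
    add_le_add (norm_le_jb ξ₁) (norm_le_jb ξ₂)
  have h2 : √(1 + ‖ξ₁ + ξ₂‖ ^ 2) ^ 9 ≤ (√(1 + ‖ξ₁‖ ^ 2) + √(1 + ‖ξ₂‖ ^ 2)) ^ 9 :=
    pow_le_pow_left₀ (jb_pos _).le (jb_add_le ξ₁ ξ₂) 9
  have h3 := add_pow_le ha.le hb.le 10
  calc (‖ξ₁‖ + ‖ξ₂‖) * √(1 + ‖ξ₁ + ξ₂‖ ^ 2) ^ 9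
      ≤ (√(1 + ‖ξ₁‖ ^ 2) + √(1 + ‖ξ₂‖ ^ 2)) * (√(1 + ‖ξ₁‖ ^ 2) + √(1 + ‖ξ₂‖ ^ 2)) ^ 9 :=
        mul_le_mul h1 h2 (by positivity) (by positivity)
    _ = (√(1 + ‖ξ₁‖ ^ 2) + √(1 + ‖ξ₂‖ ^ 2)) ^ 10 := by ring
    _ ≤ 2 ^ (10 - 1) * (√(1 + ‖ξ₁‖ ^ 2) ^ 10 + √(1 + ‖ξ₂‖ ^ 2) ^ 10) := h3
    _ = 2 ^ 9 * (√(1 + ‖ξ₁‖ ^ 2) ^ 10 + √(1 + ‖ξ₂‖ ^ 2) ^ 10) := by norm_num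

/-! ### The weighted pointwise bound for `Λ` -/

/-- **Weighted pointwise bound for Tao's symbol (1.4)**:
`|Λ_{ξ₁,ξ₂}(X₁,X₂,X₃)| ≤ 2⁹ (⟨ξ₁⟩¹⁰|X₁||X₂| + |X₁|⟨ξ₂⟩¹⁰|X₂|) · ⟨ξ₃⟩⁻⁹|X₃|`, `ξ₃ = -ξ₁-ξ₂`. -/
theorem norm_Λ_le_weighted (ξ₁ ξ₂ : EuclideanSpace ℝ (Fin 3)) (X₁ X₂ X₃ : EuclideanSpace ℂ (Fin 3)) :
    ‖Λ ξ₁ ξ₂ X₁ X₂ X₃‖ ≤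
      2 ^ 9 * ((√(1 + ‖ξ₁‖ ^ 2) ^ 10 * ‖X₁‖) * ‖X₂‖ + ‖X₁‖ * (√(1 + ‖ξ₂‖ ^ 2) ^ 10 * ‖X₂‖)) *
        ((√(1 + ‖-ξ₁ - ξ₂‖ ^ 2))⁻¹ ^ 9 * ‖X₃‖) := by
  have hc : √(1 + ‖-ξ₁ - ξ₂‖ ^ 2) = √(1 + ‖ξ₁ + ξ₂‖ ^ 2) := by
    rw [show -ξ₁ - ξ₂ = -(ξ₁ + ξ₂) by abel, norm_neg]
  have hcpos : 0 < √(1 + ‖-ξ₁ - ξ₂‖ ^ 2) := jb_pos _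
  have key : ‖ξ₁‖ + ‖ξ₂‖ ≤ 2 ^ 9 * (√(1 + ‖ξ₁‖ ^ 2) ^ 10 + √(1 + ‖ξ₂‖ ^ 2) ^ 10) *
      (√(1 + ‖-ξ₁ - ξ₂‖ ^ 2))⁻¹ ^ 9 := by
    rw [inv_pow, ← div_eq_mul_inv, le_div_iff₀ (pow_pos hcpos 9), hc]
    exact weight_ineq ξ₁ ξ₂
  calc ‖Λ ξ₁ ξ₂ X₁ X₂ X₃‖
      ≤ ‖X₁‖ * ‖ξ₂‖ * (‖X₂‖ * ‖X₃‖) + ‖X₂‖ * ‖ξ₁‖ * (‖X₁‖ * ‖X₃‖) := norm_Λ_le ξ₁ ξ₂ X₁ X₂ X₃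
    _ = (‖ξ₁‖ + ‖ξ₂‖) * (‖X₁‖ * ‖X₂‖ * ‖X₃‖) := by ring
    _ ≤ (2 ^ 9 * (√(1 + ‖ξ₁‖ ^ 2) ^ 10 + √(1 + ‖ξ₂‖ ^ 2) ^ 10) *
          (√(1 + ‖-ξ₁ - ξ₂‖ ^ 2))⁻¹ ^ 9) * (‖X₁‖ * ‖X₂‖ * ‖X₃‖) :=
        mul_le_mul_of_nonneg_right key (by positivity)
    _ = _ := by ring

/-- `(⟨ξ⟩¹⁰)² = (1+|ξ|²)¹⁰`: the square of the high weight is the `H¹⁰` weight. -/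
theorem wHi_sq (ξ : EuclideanSpace ℝ (Fin 3)) :
    ENNReal.ofReal (√(1 + ‖ξ‖ ^ 2) ^ 10) ^ 2 = ENNReal.ofReal ((1 + ‖ξ‖ ^ 2) ^ (10 : ℝ)) := by
  rw [← ENNReal.ofReal_pow (by positivity), ← pow_mul, show 10 * 2 = 2 * 10 by norm_num, pow_mul,
    jb_sq, show (10 : ℝ) = ((10 : ℕ) : ℝ) by norm_num, Real.rpow_natCast]

/-- `(⟨ξ⟩⁻⁹)² = (1+|ξ|²)⁻⁹`: the square of the low weight is the `H⁻⁹` weight. -/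
theorem wLo_sq (ξ : EuclideanSpace ℝ (Fin 3)) :
    ENNReal.ofReal ((√(1 + ‖ξ‖ ^ 2))⁻¹ ^ 9) ^ 2 = ENNReal.ofReal ((1 + ‖ξ‖ ^ 2) ^ (-9 : ℝ)) := by
  have h0 : (0 : ℝ) ≤ 1 + ‖ξ‖ ^ 2 := by positivity
  rw [← ENNReal.ofReal_pow (by positivity), ← pow_mul, show 9 * 2 = 2 * 9 by norm_num, pow_mul,
    inv_pow, jb_sq, Real.rpow_neg h0, show (9 : ℝ) = ((9 : ℕ) : ℝ) by norm_num, Real.rpow_natCast,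
    inv_pow]

/-- The high weight is measurable. -/
theorem measurable_wHi :
    Measurable fun ξ : EuclideanSpace ℝ (Fin 3) => ENNReal.ofReal (√(1 + ‖ξ‖ ^ 2) ^ 10) :=
  ((continuous_jb.pow 10).measurable).ennreal_ofReal

/-- The low weight is measurable. -/
theorem measurable_wLo :
    Measurable fun ξ : EuclideanSpace ℝ (Fin 3) => ENNReal.ofReal ((√(1 + ‖ξ‖ ^ 2))⁻¹ ^ 9) :=
  ((continuous_jb.inv₀ fun ξ => (jb_pos ξ).ne').pow 9).measurable.ennreal_ofReal

/-- **Weighted pointwise bound for `Λ` in `ℝ≥0∞`**: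
`‖Λ‖ₑ ≤ 2⁹ (⟨ξ₁⟩¹⁰‖X₁‖ ‖X₂‖ + ‖X₁‖ ⟨ξ₂⟩¹⁰‖X₂‖) · (⟨ξ₃⟩⁻⁹ ‖X₃‖)`. -/
theorem enorm_Λ_le_weighted (ξ₁ ξ₂ : EuclideanSpace ℝ (Fin 3)) (X₁ X₂ X₃ : EuclideanSpace ℂ (Fin 3)) :
    ‖Λ ξ₁ ξ₂ X₁ X₂ X₃‖ₑ ≤
      2 ^ 9 * ((ENNReal.ofReal (√(1 + ‖ξ₁‖ ^ 2) ^ 10) * ‖X₁‖ₑ) * ‖X₂‖ₑ +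
          ‖X₁‖ₑ * (ENNReal.ofReal (√(1 + ‖ξ₂‖ ^ 2) ^ 10) * ‖X₂‖ₑ)) *
        (ENNReal.ofReal ((√(1 + ‖-ξ₁ - ξ₂‖ ^ 2))⁻¹ ^ 9) * ‖X₃‖ₑ) := by
  rw [← ofReal_norm (Λ ξ₁ ξ₂ X₁ X₂ X₃)]
  refine (ENNReal.ofReal_le_ofReal (norm_Λ_le_weighted ξ₁ ξ₂ X₁ X₂ X₃)).trans_eq ?_
  rw [ENNReal.ofReal_mul (by positivity), ENNReal.ofReal_mul (by positivity),
    ENNReal.ofReal_add (by positivity) (by positivity), ENNReal.ofReal_mul (by positivity),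
    ENNReal.ofReal_mul (by positivity), ENNReal.ofReal_mul (by positivity),
    ENNReal.ofReal_mul (by positivity), ENNReal.ofReal_mul (by positivity),
    ENNReal.ofReal_pow (by norm_num), ENNReal.ofReal_ofNat, ofReal_norm, ofReal_norm, ofReal_norm]

/-! ### The weighted trilinear estimate -/

/-- **Cauchy–Schwarz in the inner variable** for `ℝ≥0∞`-valued densities:
`∫ A(ξ) B(c - ξ) dξ ≤ (∫ A²)^{1/2} (∫ B²)^{1/2}` (the substitution `ξ ↦ c - ξ` preserves
Lebesgue measure). -/
theorem lintegral_mul_comp_sub_le {A B : EuclideanSpace ℝ (Fin 3) → ℝ≥0∞} (hA : AEMeasurable A volume)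
    (hB : AEMeasurable B volume) (c : EuclideanSpace ℝ (Fin 3)) :
    ∫⁻ ξ, A ξ * B (c - ξ) ≤ (∫⁻ ξ, A ξ ^ 2) ^ (1 / 2 : ℝ) * (∫⁻ ξ, B ξ ^ 2) ^ (1 / 2 : ℝ) := by
  have hmp : MeasurePreserving (fun ξ : EuclideanSpace ℝ (Fin 3) => c - ξ) volume volume :=
    Measure.measurePreserving_sub_left volume c
  have hB' : AEMeasurable (fun ξ => B (c - ξ)) volume :=
    hB.comp_quasiMeasurePreserving hmp.quasiMeasurePreserving
  calc ∫⁻ ξ, A ξ * B (c - ξ)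
      ≤ (∫⁻ ξ, A ξ ^ (2 : ℝ)) ^ (1 / (2 : ℝ)) * (∫⁻ ξ, B (c - ξ) ^ (2 : ℝ)) ^ (1 / (2 : ℝ)) :=
        ENNReal.lintegral_mul_le_Lp_mul_Lq volume Real.HolderConjugate.two_two hA hB'
    _ = (∫⁻ ξ, A ξ ^ 2) ^ (1 / 2 : ℝ) * (∫⁻ ξ, B ξ ^ 2) ^ (1 / 2 : ℝ) := by
        rw [lintegral_sub_left_eq_self (fun ξ => B ξ ^ (2 : ℝ)) c]
        simp only [ENNReal.rpow_two]

/-- **The weighted trilinear estimate for the Euler form (1.3)**: for measurable fields `f, g, h`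
on frequency space,
`∫∫ |Λ(f(ξ₁), g(ξ₂), h(-ξ₁-ξ₂))| ≤ 2⁹ (‖g‖₁ ‖⟨ξ⟩¹⁰f‖₂ + ‖f‖₁ ‖⟨ξ⟩¹⁰g‖₂) ‖⟨ξ⟩⁻⁹h‖₂`
(Tonelli, Cauchy–Schwarz in the inner variable, translation invariance). -/
theorem lintegral_enorm_Λ_le_weighted {f g h : EuclideanSpace ℝ (Fin 3) → EuclideanSpace ℂ (Fin 3)}
    (hf : AEStronglyMeasurable f volume) (hg : AEStronglyMeasurable g volume)
    (hh : AEStronglyMeasurable h volume) :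
    ∫⁻ p : EuclideanSpace ℝ (Fin 3) × EuclideanSpace ℝ (Fin 3),
        ‖Λ p.1 p.2 (f p.1) (g p.2) (h (-p.1 - p.2))‖ₑ ≤
      2 ^ 9 * ((∫⁻ ξ, ‖g ξ‖ₑ) *
            (∫⁻ ξ, (ENNReal.ofReal (√(1 + ‖ξ‖ ^ 2) ^ 10) * ‖f ξ‖ₑ) ^ 2) ^ (1 / 2 : ℝ) +
          (∫⁻ ξ, ‖f ξ‖ₑ) *
            (∫⁻ ξ, (ENNReal.ofReal (√(1 + ‖ξ‖ ^ 2) ^ 10) * ‖g ξ‖ₑ) ^ 2) ^ (1 / 2 : ℝ)) *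
        (∫⁻ ξ, (ENNReal.ofReal ((√(1 + ‖ξ‖ ^ 2))⁻¹ ^ 9) * ‖h ξ‖ₑ) ^ 2) ^ (1 / 2 : ℝ) := by
  rw [Measure.volume_eq_prod]
  set μ : Measure (EuclideanSpace ℝ (Fin 3)) := volume with hμ
  -- the weighted densities
  set F : EuclideanSpace ℝ (Fin 3) → ℝ≥0∞ :=
    fun ξ => ENNReal.ofReal (√(1 + ‖ξ‖ ^ 2) ^ 10) * ‖f ξ‖ₑ with hFdef
  set G : EuclideanSpace ℝ (Fin 3) → ℝ≥0∞ :=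
    fun ξ => ENNReal.ofReal (√(1 + ‖ξ‖ ^ 2) ^ 10) * ‖g ξ‖ₑ with hGdef
  set H : EuclideanSpace ℝ (Fin 3) → ℝ≥0∞ :=
    fun ξ => ENNReal.ofReal ((√(1 + ‖ξ‖ ^ 2))⁻¹ ^ 9) * ‖h ξ‖ₑ with hHdef
  have hFm : AEMeasurable F μ := measurable_wHi.aemeasurable.mul hf.enorm
  have hGm : AEMeasurable G μ := measurable_wHi.aemeasurable.mul hg.enorm
  have hHm : AEMeasurable H μ := measurable_wLo.aemeasurable.mul hh.enorm
  -- measurability of the pieces on the product space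
  have hf1 : AEMeasurable (fun p : EuclideanSpace ℝ (Fin 3) × EuclideanSpace ℝ (Fin 3) => ‖f p.1‖ₑ)
      (μ.prod μ) :=
    (hf.comp_quasiMeasurePreserving Measure.quasiMeasurePreserving_fst).enorm
  have hg2 : AEMeasurable (fun p : EuclideanSpace ℝ (Fin 3) × EuclideanSpace ℝ (Fin 3) => ‖g p.2‖ₑ)
      (μ.prod μ) :=
    (hg.comp_quasiMeasurePreserving Measure.quasiMeasurePreserving_snd).enorm
  have hF1 : AEMeasurable (fun p : EuclideanSpace ℝ (Fin 3) × EuclideanSpace ℝ (Fin 3) => F p.1)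
      (μ.prod μ) :=
    hFm.comp_quasiMeasurePreserving Measure.quasiMeasurePreserving_fst
  have hG2 : AEMeasurable (fun p : EuclideanSpace ℝ (Fin 3) × EuclideanSpace ℝ (Fin 3) => G p.2)
      (μ.prod μ) :=
    hGm.comp_quasiMeasurePreserving Measure.quasiMeasurePreserving_snd
  have hH3 : AEMeasurable (fun p : EuclideanSpace ℝ (Fin 3) × EuclideanSpace ℝ (Fin 3) =>
      H (-p.1 - p.2)) (μ.prod μ) :=
    hHm.comp_quasiMeasurePreserving quasiMeasurePreserving_neg_fst_sub_snd
  -- the two Tonelli terms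
  set T₁ : EuclideanSpace ℝ (Fin 3) × EuclideanSpace ℝ (Fin 3) → ℝ≥0∞ :=
    fun p => 2 ^ 9 * (‖g p.2‖ₑ * (F p.1 * H (-p.1 - p.2))) with hT₁
  set T₂ : EuclideanSpace ℝ (Fin 3) × EuclideanSpace ℝ (Fin 3) → ℝ≥0∞ :=
    fun p => 2 ^ 9 * (‖f p.1‖ₑ * (G p.2 * H (-p.1 - p.2))) with hT₂
  have hT₁m : AEMeasurable T₁ (μ.prod μ) := (hg2.mul (hF1.mul hH3)).const_mul _
  have hT₂m : AEMeasurable T₂ (μ.prod μ) := (hf1.mul (hG2.mul hH3)).const_mul _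
  set WF : ℝ≥0∞ := (∫⁻ ξ, F ξ ^ 2 ∂μ) ^ (1 / 2 : ℝ) with hWF
  set WG : ℝ≥0∞ := (∫⁻ ξ, G ξ ^ 2 ∂μ) ^ (1 / 2 : ℝ) with hWG
  set WH : ℝ≥0∞ := (∫⁻ ξ, H ξ ^ 2 ∂μ) ^ (1 / 2 : ℝ) with hWH
  have h29 : (2 : ℝ≥0∞) ^ 9 ≠ ∞ := ENNReal.pow_ne_top ENNReal.ofNat_ne_top
  -- first term: integrate `ξ₁` inside
  have h1 : ∫⁻ p, T₁ p ∂(μ.prod μ) ≤ 2 ^ 9 * ((∫⁻ ξ, ‖g ξ‖ₑ ∂μ) * (WF * WH)) := by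
    rw [lintegral_prod_symm _ hT₁m]
    calc ∫⁻ ξ₂, ∫⁻ ξ₁, T₁ (ξ₁, ξ₂) ∂μ ∂μ
        = ∫⁻ ξ₂, 2 ^ 9 * (‖g ξ₂‖ₑ * ∫⁻ ξ₁, F ξ₁ * H (-ξ₂ - ξ₁) ∂μ) ∂μ := by
          refine lintegral_congr fun ξ₂ => ?_
          simp only [hT₁]
          rw [lintegral_const_mul' _ _ h29, lintegral_const_mul' _ _ enorm_ne_top]
          congr 2
          refine lintegral_congr fun ξ₁ => ?_
          rw [show -ξ₁ - ξ₂ = -ξ₂ - ξ₁ by abel]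
      _ ≤ ∫⁻ ξ₂, 2 ^ 9 * (‖g ξ₂‖ₑ * (WF * WH)) ∂μ := by
          refine lintegral_mono fun ξ₂ => mul_le_mul' le_rfl (mul_le_mul' le_rfl ?_)
          exact lintegral_mul_comp_sub_le hFm hHm (-ξ₂)
      _ = 2 ^ 9 * ((∫⁻ ξ, ‖g ξ‖ₑ ∂μ) * (WF * WH)) := by
          rw [lintegral_const_mul' _ _ h29, lintegral_mul_const'' _ hg.enorm]
  -- second term: integrate `ξ₂` inside
  have h2 : ∫⁻ p, T₂ p ∂(μ.prod μ) ≤ 2 ^ 9 * ((∫⁻ ξ, ‖f ξ‖ₑ ∂μ) * (WG * WH)) := by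
    rw [lintegral_prod _ hT₂m]
    calc ∫⁻ ξ₁, ∫⁻ ξ₂, T₂ (ξ₁, ξ₂) ∂μ ∂μ
        = ∫⁻ ξ₁, 2 ^ 9 * (‖f ξ₁‖ₑ * ∫⁻ ξ₂, G ξ₂ * H (-ξ₁ - ξ₂) ∂μ) ∂μ := by
          refine lintegral_congr fun ξ₁ => ?_
          simp only [hT₂]
          rw [lintegral_const_mul' _ _ h29, lintegral_const_mul' _ _ enorm_ne_top]
      _ ≤ ∫⁻ ξ₁, 2 ^ 9 * (‖f ξ₁‖ₑ * (WG * WH)) ∂μ := by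
          refine lintegral_mono fun ξ₁ => mul_le_mul' le_rfl (mul_le_mul' le_rfl ?_)
          exact lintegral_mul_comp_sub_le hGm hHm (-ξ₁)
      _ = 2 ^ 9 * ((∫⁻ ξ, ‖f ξ‖ₑ ∂μ) * (WG * WH)) := by
          rw [lintegral_const_mul' _ _ h29, lintegral_mul_const'' _ hf.enorm]
  calc ∫⁻ p, ‖Λ p.1 p.2 (f p.1) (g p.2) (h (-p.1 - p.2))‖ₑ ∂(μ.prod μ)
      ≤ ∫⁻ p, (T₁ p + T₂ p) ∂(μ.prod μ) := by
        refine lintegral_mono fun p => ?_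
        rw [hT₁, hT₂]
        convert enorm_Λ_le_weighted p.1 p.2 (f p.1) (g p.2) (h (-p.1 - p.2)) using 1
        simp only [hFdef, hGdef, hHdef]
        ring
    _ = ∫⁻ p, T₁ p ∂(μ.prod μ) + ∫⁻ p, T₂ p ∂(μ.prod μ) := lintegral_add_left' hT₁m _
    _ ≤ 2 ^ 9 * ((∫⁻ ξ, ‖g ξ‖ₑ ∂μ) * (WF * WH)) + 2 ^ 9 * ((∫⁻ ξ, ‖f ξ‖ₑ ∂μ) * (WG * WH)) :=
        add_le_add h1 h2
    _ = _ := by ring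

/-! ### Specialisation to Fourier transforms: `H¹⁰ × H¹⁰ × H⁻⁹` -/

/-- The embedding constant `C_emb = (∫_{ℝ³} (1+|ξ|²)^{-10} dξ)^{1/2}` of `H¹⁰(ℝ³) ⊂ 𝓕L¹` is finite. -/
theorem Cemb_lt_top :
    (∫⁻ ξ : EuclideanSpace ℝ (Fin 3), ENNReal.ofReal ((1 + ‖ξ‖ ^ 2) ^ (-10 : ℝ))) ^ (1 / 2 : ℝ) < ∞ :=
  ENNReal.rpow_lt_top_of_nonneg (by norm_num) lintegral_inv_sobolevWeight_lt_top.ne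

/-- `‖⟨ξ⟩¹⁰ ĝ‖²_{L²} = ∫ (1+|ξ|²)¹⁰ |ĝ|²`: the high-weight `L²` norm is the `H¹⁰` integral. -/
theorem lintegral_wHi_mul_sq (g : EuclideanSpace ℝ (Fin 3) → EuclideanSpace ℂ (Fin 3)) :
    ∫⁻ ξ, (ENNReal.ofReal (√(1 + ‖ξ‖ ^ 2) ^ 10) * ‖g ξ‖ₑ) ^ 2 = sobolevWeightIntegral 10 g := by
  unfold sobolevWeightIntegral
  refine lintegral_congr fun ξ => ?_
  rw [mul_pow, wHi_sq]

/-- `‖⟨ξ⟩⁻⁹ ĝ‖²_{L²} = ∫ (1+|ξ|²)⁻⁹ |ĝ|²`: the low-weight `L²` norm is the `H⁻⁹` integral. -/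
theorem lintegral_wLo_mul_sq (g : EuclideanSpace ℝ (Fin 3) → EuclideanSpace ℂ (Fin 3)) :
    ∫⁻ ξ, (ENNReal.ofReal ((√(1 + ‖ξ‖ ^ 2))⁻¹ ^ 9) * ‖g ξ‖ₑ) ^ 2 = sobolevWeightIntegral (-9) g := by
  unfold sobolevWeightIntegral
  refine lintegral_congr fun ξ => ?_
  rw [mul_pow, wLo_sq]

/-- **Absolute convergence of (1.3) against `H⁻⁹` test fields**: for `u, v, w ∈ L²`,
`∫∫ |Λ(û(ξ₁), v̂(ξ₂), ŵ(-ξ₁-ξ₂))| ≤ 2⁹ · 2 C_emb ‖u‖_{H¹⁰} ‖v‖_{H¹⁰} ‖w‖_{H⁻⁹}`. -/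
theorem lintegral_enorm_Λ_fourierFn_le_weighted (u v w : L2C) :
    ∫⁻ p : EuclideanSpace ℝ (Fin 3) × EuclideanSpace ℝ (Fin 3),
        ‖Λ p.1 p.2 (fourierFn u p.1) (fourierFn v p.2) (fourierFn w (-p.1 - p.2))‖ₑ ≤
      2 ^ 9 * (2 * (∫⁻ ξ : EuclideanSpace ℝ (Fin 3),
          ENNReal.ofReal ((1 + ‖ξ‖ ^ 2) ^ (-10 : ℝ))) ^ (1 / 2 : ℝ)) *
        eFourierSobolevNorm 10 u * eFourierSobolevNorm 10 v * eFourierSobolevNorm (-9) w := by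
  set C : ℝ≥0∞ := (∫⁻ ξ : EuclideanSpace ℝ (Fin 3),
    ENNReal.ofReal ((1 + ‖ξ‖ ^ 2) ^ (-10 : ℝ))) ^ (1 / 2 : ℝ) with hC
  have hu := lintegral_enorm_le_sobolevWeight (f := fourierFn u) (aestronglyMeasurable_fourierFn u)
  have hv := lintegral_enorm_le_sobolevWeight (f := fourierFn v) (aestronglyMeasurable_fourierFn v)
  rw [← hC, ← eFourierSobolevNorm_eq] at hu hv
  refine (lintegral_enorm_Λ_le_weighted (aestronglyMeasurable_fourierFn u)
    (aestronglyMeasurable_fourierFn v) (aestronglyMeasurable_fourierFn w)).trans ?_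
  rw [lintegral_wHi_mul_sq, lintegral_wHi_mul_sq, lintegral_wLo_mul_sq, ← eFourierSobolevNorm_eq,
    ← eFourierSobolevNorm_eq, ← eFourierSobolevNorm_eq]
  refine mul_le_mul' ?_ le_rfl
  rw [mul_assoc, mul_assoc]
  refine mul_le_mul' le_rfl ?_
  calc (∫⁻ ξ, ‖fourierFn v ξ‖ₑ) * eFourierSobolevNorm 10 u +
        (∫⁻ ξ, ‖fourierFn u ξ‖ₑ) * eFourierSobolevNorm 10 v
      ≤ C * eFourierSobolevNorm 10 v * eFourierSobolevNorm 10 u +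
          C * eFourierSobolevNorm 10 u * eFourierSobolevNorm 10 v :=
        add_le_add (mul_le_mul' hv le_rfl) (mul_le_mul' hu le_rfl)
    _ = 2 * C * (eFourierSobolevNorm 10 u * eFourierSobolevNorm 10 v) := by ring

/-- **The Euler form is bounded on `H¹⁰ × H¹⁰ × H⁻⁹`** (the one-derivative loss of `B`, Tao 2016
(1.14), in duality form): `|⟨B(u,v), w⟩| ≤ π · 2¹⁰ C_emb ‖u‖_{H¹⁰} ‖v‖_{H¹⁰} ‖w‖_{H⁻⁹}` for all
`u, v, w ∈ L²(ℝ³; ℂ³)`, `C_emb = (∫ (1+|ξ|²)^{-10})^{1/2}`. -/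
theorem enorm_eulerForm_le_weighted (u v w : L2C) :
    ‖eulerForm u v w‖ₑ ≤ ENNReal.ofReal Real.pi *
      (2 ^ 9 * (2 * (∫⁻ ξ : EuclideanSpace ℝ (Fin 3),
          ENNReal.ofReal ((1 + ‖ξ‖ ^ 2) ^ (-10 : ℝ))) ^ (1 / 2 : ℝ)) *
        eFourierSobolevNorm 10 u * eFourierSobolevNorm 10 v * eFourierSobolevNorm (-9) w) := by
  have hπ : ‖-((Real.pi : ℂ) * I)‖ₑ = ENNReal.ofReal Real.pi := by
    rw [enorm_neg, enorm_mul, ← ofReal_norm, ← ofReal_norm, Complex.norm_I, ENNReal.ofReal_one,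
      mul_one, Complex.norm_real, Real.norm_of_nonneg Real.pi_pos.le]
  unfold eulerForm
  rw [enorm_mul, hπ]
  exact mul_le_mul' le_rfl ((enorm_integral_le_lintegral_enorm _).trans
    (lintegral_enorm_Λ_fourierFn_le_weighted u v w))

/-! ### Monotonicity of the Sobolev scale -/

/-- **The Sobolev scale is monotone**: `‖f‖_{H^s} ≤ ‖f‖_{H^t}` for `s ≤ t` (the weight
`(1+|ξ|²)^s` is monotone in `s` since `1+|ξ|² ≥ 1`). -/
theorem eFourierSobolevNorm_mono {s t : ℝ} (hst : s ≤ t) (f : L2C) :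
    eFourierSobolevNorm s f ≤ eFourierSobolevNorm t f := by
  unfold eFourierSobolevNorm
  refine ENNReal.rpow_le_rpow (lintegral_mono fun ξ => ?_) (by norm_num)
  exact mul_le_mul' (ENNReal.ofReal_le_ofReal
    (Real.rpow_le_rpow_of_exponent_le (le_add_of_nonneg_right (sq_nonneg _)) hst)) le_rfl

/-- `‖w‖_{H⁻⁹} ≤ ‖w‖_{L²}`. -/
theorem eFourierSobolevNorm_neg_nine_le_enorm (w : L2C) : eFourierSobolevNorm (-9) w ≤ ‖w‖ₑ := by
  rw [← Literature.Analysis.FunctionSpaces.eFourierSobolevNorm_zero_eq_enorm]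
  exact eFourierSobolevNorm_mono (by norm_num) w

end Summit.NavierStokesRegularity.NavierStokesRegularity.Theorems.PerpetualPumpThesis.B

namespace Summit.NavierStokesRegularity.NavierStokesRegularity.Theorems.PerpetualPumpThesis

open Literature.Analysis.FluidPDE Literature.Analysis.FluidPDE.Tao2016
open Literature.Analysis.FunctionSpaces (eFourierSobolevNorm)

/-- **Part W of stub B (registered sub-goal `stub_bilinearOperator_W`)**: the Euler form (1.3)
is bounded on `H¹⁰ × H¹⁰ × H⁻⁹`,
`|⟨B(u,v), w⟩| ≤ π · 2¹⁰ (∫ (1+|ξ|²)^{-10})^{1/2} ‖u‖_{H¹⁰} ‖v‖_{H¹⁰} ‖w‖_{H⁻⁹}` for all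
`u, v, w ∈ L²(ℝ³; ℂ³)` (Tao 2016, (1.14): `B`, and hence `B̃`, loses one derivative). -/
theorem stub_bilinearOperator_W : ∀ u v w : L2C, ‖eulerForm u v w‖ₑ ≤ ENNReal.ofReal Real.pi * (2 ^ 9 * (2 * (∫⁻ ξ : EuclideanSpace ℝ (Fin 3), ENNReal.ofReal ((1 + ‖ξ‖ ^ 2) ^ (-10 : ℝ))) ^ (1 / 2 : ℝ)) * eFourierSobolevNorm 10 u * eFourierSobolevNorm 10 v * eFourierSobolevNorm (-9) w) :=
  fun u v w => B.enorm_eulerForm_le_weighted u v w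

end Summit.NavierStokesRegularity.NavierStokesRegularity.Theorems.PerpetualPumpThesis
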